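import Literature.AlgebraicGeometry.Motives.HodgeThetaSubalgebraSymplecticRankTen
import HarnessLib

/-!
# Weight one: a raising operator of MINIMAL RANK is a tripotent (`B B̄ B = t B`, `t ≠ 0`), and a RANK-ONE raising operator
# forces `𝔤_ℂ = 𝔰𝔭(V, ψ)_ℂ` in every rank (Moonen–Zarhin 1999 (2.3); Loos' Peirce calculus in the raising space)

Family `hodge`, layer `Literature/AlgebraicGeometry/Motives`; THEOREMS ONLY (no definition, no named fact; D-0026).  Written for the
cell `pub-hodgeav-hg6` (LADDER-HodgeAV row 2, TABLE X row 1 `g6.I(1)`: brick N4 of the row-1 programme «`End⁰ = ℚ`, `g = 6` ⟹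
`Hg = Sp₁₂`»; honest framing of that cell: HC / HC_AV / HC_CM NOT proved — this file is unconditional Hodge–Lie linear algebra).

SETTING.  `H` effective polarized of weight `1`, `Θ` the Hodge operator (`P = V^{1,0}`, `Q = V^{0,1}`), `𝔊 ⊆ End(V_ℂ)` a
bracket-closed complex subspace of `𝔥_ℂ = Lie Hg ⊗ ℂ` (so its elements are `ψ_ℂ`-skew), `B ∈ 𝔊` RAISING (`BP = 0`, `BV ⊆ P`)
with conjugate `B̄ = conj ∘ B ∘ conj ∈ 𝔊` (lowering).  The raising space of `𝔊` is stable under `X ↦ {X, Y, Z} = X Ȳ Z + Z Ȳ X`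
(`= [[X, Ȳ], Z]`): it is a Jordan triple system, and this file proves the first fact of its Peirce theory, classification-free.

* §1 **`WeightOneMinimalRaising.mul_conjOp_mul_eq_smul`** — if `B ≠ 0` has MINIMAL rank among the non-zero raising operators of
  `𝔊`, then `B B̄ B = t • B` with `t ≠ 0`.  PROOF: `B B̄ B = ½ [[B, B̄], B] ∈ 𝔊` (`B² = 0`) is raising with range inside
  `U = range B`; `B B̄` restricts to an endomorphism of `U ≠ 0`, which has an eigenvalue `t` with eigenvector `B v₀` (`ℂ`
  algebraically closed); then `B B̄ B − t B ∈ 𝔊` is raising, kills `ker B` and `v₀ ∉ ker B`, so has smaller rank, hence is `0`.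
  If `t = 0` then `(B B̄|_P)² = 0` for the `ψ_ℂ(·, conj ·)`-self-adjoint `B B̄|_P` (Hodge–Riemann II), so `B B̄|_P = 0` and `B = 0`.
  CONSEQUENCE (`…isIdempotentElem…`): `t⁻¹ [B, B̄]` restricts to `P` as the IDEMPOTENT `t⁻¹ B B̄|_P` of rank `rank B` — the Levi
  line algebra contains a projector onto `range B` (for `dim V = 12`: the rank-twelve case tree is reduced to minimal raising rank
  `r ∈ {1, …, 6}`, `r = 6` being the plus line).
* §2 **`WeightOneMinimalRaising.mem_of_skew_of_rank_one`** — if `𝔊` is `ad Θ`-closed with `Θ ∈ 𝔊`, `V_ℂ` has no `𝔊`-stable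
  subspace other than `0, V_ℂ`, and `𝔊` contains a raising operator of RANK ONE, then `𝔊` contains EVERY `ψ_ℂ`-skew operator
  (`𝔤_ℂ = 𝔰𝔭(V, ψ)_ℂ`): §1 with `r = 1` gives the rank-one idempotent `t⁻¹[B, B̄]|_P = ψ_ℂ(·, ξ) a` required by the tree's
  `SymplecticThetaSix.core_of_rankOne` (any rank).  For `End_Hdg = ℚ` the irreducibility is the tree's
  `SymplecticTheta.eq_bot_or_top_of_stable`; the rank-six / rank-ten files obtain the rank-one element from their dimension; here it
  is an INPUT, valid in every rank.

## References

* [MoonenZarhin1999LowDim] B. Moonen, Yu. Zarhin, *Hodge classes on abelian varieties of low dimension*, Math. Ann. 315 (1999),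
  §2 (2.3) (`Hg = Sp`), §3 (3.1).
* [Deligne1982HodgeCycles] P. Deligne, *Hodge cycles on abelian varieties*, LNM 900 (1982), I §3 (proof of Prop. 3.4, 3.6).
* O. Loos, *Bounded symmetric domains and Jordan pairs* (Irvine 1977), §3 (tripotents, Peirce decomposition; terminology only,
  not a cite key).
* [GoodmanWallachGTM255] R. Goodman, N. R. Wallach, GTM 255 (2009), §2.1.2 (`𝔰𝔭` in block form).
-/

noncomputable section

open scoped TensorProduct

namespace Literature.AlgebraicGeometry.Motives

universe u

namespace HodgeStructure

variable {V : Type u} [AddCommGroup V] [Module ℚ V] [Module.Finite ℚ V] [HodgeTensorFacts.{u, u}] {n : ℤ}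

/-! ## §1 Minimal raising operators are tripotents -/

set_option maxHeartbeats 800000 in
/-- **A raising operator of minimal rank is a tripotent: `B B̄ B = t B` with `t ≠ 0`.**  `H` effective polarized of weight
`1`; `𝔊 ⊆ 𝔥_ℂ` bracket-closed; `B ∈ 𝔊` raising, non-zero, of minimal rank among the non-zero raising elements of `𝔊`, with
conjugate `B̄ ∈ 𝔊`.  Then `B B̄ B = t • B` for a NON-ZERO scalar `t` (the restriction `B B̄|_{range B}` has an eigenvalue `t`;
`B B̄ B − tB` is a raising element of `𝔊` of smaller rank; `t = 0` would make the Hodge–Riemann-self-adjoint `B B̄|_P` nilpotent).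
[cite: MoonenZarhin1999LowDim, §2 (2.3)] [cite: Deligne1982HodgeCycles, I §3 (proof of Prop. 3.4, 3.6)]
[cite: GoodmanWallachGTM255, §2.1.2] -/
theorem WeightOneMinimalRaising.mul_conjOp_mul_eq_smul (H : HodgeStructure V n) (ψ : H.Polarization) (hn : n = 1)
    (heff : H.IsEffective) {Θ : Module.End ℂ (ℂ ⊗[ℚ] V)} (hΘ : ∀ p, ∀ x ∈ H.piece p (n - p), Θ x = ((2 * p - n : ℤ) : ℂ) • x)
    {𝔊 : Submodule ℂ (Module.End ℂ (ℂ ⊗[ℚ] V))} (h𝔊 : 𝔊 ≤ H.hodgeLieC) (hbr : ∀ Y ∈ 𝔊, ∀ Z ∈ 𝔊, Y * Z - Z * Y ∈ 𝔊)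
    {B C : Module.End ℂ (ℂ ⊗[ℚ] V)} (hB : B ∈ 𝔊) (hB0 : B ≠ 0) (hBP : ∀ p ∈ H.piece 1 0, B p = 0)
    (hBim : ∀ v, B v ∈ H.piece 1 0) (hC : ∀ v, C v = conj (B (conj v))) (hC𝔊 : C ∈ 𝔊)
    (hmin : ∀ B' ∈ 𝔊, B' ≠ 0 → (∀ p ∈ H.piece 1 0, B' p = 0) → (∀ v, B' v ∈ H.piece 1 0) →
      Module.finrank ℂ (LinearMap.range B) ≤ Module.finrank ℂ (LinearMap.range B')) :
    ∃ t : ℂ, t ≠ 0 ∧ B * C * B = t • B := by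
  classical
  subst hn
  obtain ⟨hPmem, hQmem, hΘ10, hΘ01, hΘΘ⟩ := UnitaryTheta.theta_facts H rfl heff hΘ
  have hPQ0 : ∀ x, x ∈ H.piece 1 0 → x ∈ H.piece 0 1 → x = 0 := fun x hP hQ => by
    have h1 := hΘ10 x hP
    rw [hΘ01 x hQ] at h1
    have h2 : (2 : ℂ) • x = 0 := by rw [two_smul]; nth_rewrite 1 [← h1]; rw [neg_add_cancel]
    exact (smul_eq_zero.1 h2).resolve_left (two_ne_zero' ℂ)
  obtain ⟨hCQ, hCim, -, hconjB⟩ := SymplecticThetaTen.conjOp_raise (P := H.piece 1 0) (Q := H.piece 0 1)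
    (fun x hx => conj_mem_piece H hx) (fun x hx => conj_mem_piece H hx) hBP hBim hC
  have hBskew : ∀ x y, ψ.form.baseChange ℂ (B x) y + ψ.form.baseChange ℂ x (B y) = 0 := fun x y => by
    rw [formBaseChange_skew_of_mem_hodgeLieC ψ (h𝔊 hB), neg_add_cancel]
  -- `B² = 0`, `BCB = ½ [[B, C], B] ∈ 𝔊`, raising
  have hBB : B * B = 0 := LinearMap.ext fun v => by rw [Module.End.mul_apply, hBP _ (hBim v), LinearMap.zero_apply]
  have hBCB𝔊 : B * C * B ∈ 𝔊 := by
    have h1 : B * C - C * B ∈ 𝔊 := hbr B hB C hC𝔊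
    have h2 : (B * C - C * B) * B - B * (B * C - C * B) ∈ 𝔊 := hbr _ h1 B hB
    have h3 : (B * C - C * B) * B - B * (B * C - C * B) = (2 : ℂ) • (B * C * B) := by
      rw [sub_mul, mul_sub, show C * B * B = 0 by rw [mul_assoc, hBB, mul_zero],
        show B * (B * C) = 0 by rw [← mul_assoc, hBB, zero_mul], show B * (C * B) = B * C * B by rw [mul_assoc], two_smul]
      abel
    rw [h3] at h2
    have h4 := Submodule.smul_mem 𝔊 (2 : ℂ)⁻¹ h2
    rwa [smul_smul, inv_mul_cancel₀ (two_ne_zero' ℂ), one_smul] at h4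
  -- `B C` preserves `U = range B`; an eigenvector `u₀ = B v₀`
  have hBCU : ∀ u ∈ LinearMap.range B, (B * C) u ∈ LinearMap.range B := fun u _ => LinearMap.mem_range_self B (C u)
  haveI : Nontrivial (LinearMap.range B) := by
    rw [Submodule.nontrivial_iff_ne_bot]
    intro h
    exact hB0 (LinearMap.range_eq_bot.1 h)
  obtain ⟨t, ht⟩ := Module.End.exists_eigenvalue ((B * C).restrict hBCU)
  obtain ⟨u₀, hu₀⟩ := ht.exists_hasEigenvector
  have hu₀eq : (B * C) (u₀ : ℂ ⊗[ℚ] V) = t • (u₀ : ℂ ⊗[ℚ] V) := by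
    have h := congrArg Subtype.val hu₀.apply_eq_smul
    simpa only [LinearMap.coe_restrict_apply, Submodule.coe_smul] using h
  have hu₀ne : (u₀ : ℂ ⊗[ℚ] V) ≠ 0 := fun h => hu₀.2 (Subtype.ext h)
  obtain ⟨v₀, hv₀⟩ : ∃ v₀, B v₀ = u₀ := LinearMap.mem_range.1 u₀.2
  -- `B'' = BCB − tB` is raising, in `𝔊`, of smaller rank, hence `0`
  set B'' := B * C * B - t • B with hB''
  have hB''𝔊 : B'' ∈ 𝔊 := Submodule.sub_mem _ hBCB𝔊 (Submodule.smul_mem _ _ hB)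
  have hB''P : ∀ p ∈ H.piece 1 0, B'' p = 0 := fun p hp => by
    rw [hB'', LinearMap.sub_apply, Module.End.mul_apply, Module.End.mul_apply, LinearMap.smul_apply, hBP p hp, map_zero,
      map_zero, smul_zero, sub_zero]
  have hB''im : ∀ v, B'' v ∈ H.piece 1 0 := fun v => by
    rw [hB'', LinearMap.sub_apply, Module.End.mul_apply, Module.End.mul_apply, LinearMap.smul_apply]
    exact Submodule.sub_mem _ (hBim _) (Submodule.smul_mem _ _ (hBim _))
  have hker : LinearMap.ker B ≤ LinearMap.ker B'' := fun v hv => by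
    rw [LinearMap.mem_ker] at hv ⊢
    rw [hB'', LinearMap.sub_apply, Module.End.mul_apply, Module.End.mul_apply, LinearMap.smul_apply, hv, map_zero, map_zero,
      smul_zero, sub_zero]
  have hv₀ker : v₀ ∈ LinearMap.ker B'' := by
    rw [LinearMap.mem_ker, hB'', LinearMap.sub_apply, Module.End.mul_apply, Module.End.mul_apply, LinearMap.smul_apply, hv₀,
      ← Module.End.mul_apply, hu₀eq, sub_self]
  have hv₀nker : v₀ ∉ LinearMap.ker B := fun h => hu₀ne (by rw [← hv₀]; exact h)
  have hlt : Module.finrank ℂ (LinearMap.ker B) < Module.finrank ℂ (LinearMap.ker B'') :=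
    Submodule.finrank_lt_finrank_of_lt (lt_of_le_of_ne hker fun h => hv₀nker (h ▸ hv₀ker))
  have hrk := LinearMap.finrank_range_add_finrank_ker B
  have hrk'' := LinearMap.finrank_range_add_finrank_ker B''
  have hB''0 : B'' = 0 := by
    by_contra hne
    have h := hmin B'' hB''𝔊 hne hB''P hB''im
    omega
  have hBCB : B * C * B = t • B := sub_eq_zero.1 (by rw [← hB'']; exact hB''0)
  refine ⟨t, fun ht0 => hB0 ?_, hBCB⟩
  -- `t = 0`: `B C B = 0`, so `(BC)² = 0`; `BC|_P` is self-adjoint for the definite pairing `ψ_ℂ(·, conj ·)` on `P`, hence `BC|_P = 0`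
  rw [ht0, zero_smul] at hBCB
  have hsa := fun p p' => (SymplecticThetaTen.form_mul_conjOp_conj ψ.form hC hBskew p p').1
  have hBCP : ∀ p ∈ H.piece 1 0, B (C p) = 0 := by
    intro p hp
    have hx : B (C p) ∈ H.piece 1 0 := hBim _
    by_contra hne
    obtain ⟨r, hr, hre⟩ := ψ.pos 1 0 (by norm_num) (B (C p)) hx hne
    have h0 : ψ.form.baseChange ℂ (B (C p)) (conj (B (C p))) = 0 := by
      rw [hsa p (B (C p)), show B (C (B (C p))) = (B * C * B) (C p) from rfl, hBCB, LinearMap.zero_apply, map_zero,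
        map_zero]
    rw [h0, mul_zero] at hre
    have hr0 : (r : ℂ) = 0 := hre.symm
    exact hr.ne' (by exact_mod_cast hr0)
  -- then `B = 0` on `Q` (`ψ_ℂ(Bq, conj(Bq)) = −ψ_ℂ(q, BC(conj q)) = 0`) and on `P`
  have hPQv : ∀ v : ℂ ⊗[ℚ] V, (2 : ℂ)⁻¹ • (v + Θ v) + (2 : ℂ)⁻¹ • (v - Θ v) = v := fun v => by module
  refine LinearMap.ext fun v => ?_
  rw [LinearMap.zero_apply, ← hPQv v, map_add, hBP _ (hPmem v), zero_add]
  set q := (2 : ℂ)⁻¹ • (v - Θ v) with hq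
  have hqQ : q ∈ H.piece 0 1 := hQmem v
  by_contra hne
  obtain ⟨r, hr, hre⟩ := ψ.pos 1 0 (by norm_num) (B q) (hBim q) hne
  have hconj : conj (B q) = C (conj q) := by rw [hC, conj_conj]
  rw [hconj, formBaseChange_skew_of_mem_hodgeLieC ψ (h𝔊 hB) q (C (conj q)), hBCP _ (conj_mem_piece H hqQ), map_zero,
    neg_zero, mul_zero] at hre
  have hr0 : (r : ℂ) = 0 := hre.symm
  exact hr.ne' (by exact_mod_cast hr0)

omit [Module.Finite ℚ V] [HodgeTensorFacts.{u, u}] in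
/-- **The Levi line algebra contains a projector onto `range B`**: with `t` as in `mul_conjOp_mul_eq_smul`, the operator
`E = t⁻¹ B B̄` is an idempotent of `V_ℂ` with `range E = range B`, it vanishes on `Q`, and on `P` it agrees with the Levi element
`t⁻¹ [B, B̄] ∈ 𝔊`. [cite: MoonenZarhin1999LowDim, §2 (2.3)] [cite: GoodmanWallachGTM255, §2.1.2] -/
theorem WeightOneMinimalRaising.isIdempotentElem_of_mul_conjOp_mul_eq_smul (H : HodgeStructure V n) (hn : n = 1)
    (heff : H.IsEffective) {Θ : Module.End ℂ (ℂ ⊗[ℚ] V)} (hΘ : ∀ p, ∀ x ∈ H.piece p (n - p), Θ x = ((2 * p - n : ℤ) : ℂ) • x)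
    {B C : Module.End ℂ (ℂ ⊗[ℚ] V)} (hBP : ∀ p ∈ H.piece 1 0, B p = 0) (hBim : ∀ v, B v ∈ H.piece 1 0)
    (hC : ∀ v, C v = conj (B (conj v))) {t : ℂ} (ht : t ≠ 0) (hBCB : B * C * B = t • B) :
    IsIdempotentElem (t⁻¹ • (B * C)) ∧ LinearMap.range (t⁻¹ • (B * C)) = LinearMap.range B ∧
      (∀ q ∈ H.piece 0 1, (t⁻¹ • (B * C)) q = 0) ∧ (∀ p ∈ H.piece 1 0, (t⁻¹ • (B * C - C * B)) p = (t⁻¹ • (B * C)) p) := by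
  subst hn
  obtain ⟨hCQ, -, -, -⟩ := SymplecticThetaTen.conjOp_raise (P := H.piece 1 0) (Q := H.piece 0 1)
    (fun x hx => conj_mem_piece H hx) (fun x hx => conj_mem_piece H hx) hBP hBim hC
  refine ⟨?_, ?_, fun q hq => ?_, fun p hp => ?_⟩
  · change (t⁻¹ • (B * C)) * (t⁻¹ • (B * C)) = t⁻¹ • (B * C)
    rw [smul_mul_smul_comm, ← mul_assoc, hBCB, smul_mul_assoc, smul_smul, mul_assoc t⁻¹ t⁻¹ t, inv_mul_cancel₀ ht, mul_one]
  · refine le_antisymm ?_ fun x hx => ?_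
    · rintro _ ⟨v, rfl⟩
      rw [LinearMap.smul_apply, Module.End.mul_apply]
      exact Submodule.smul_mem _ _ (LinearMap.mem_range_self B _)
    · obtain ⟨v, rfl⟩ := LinearMap.mem_range.1 hx
      refine ⟨B v, ?_⟩
      rw [LinearMap.smul_apply, show (B * C) (B v) = (B * C * B) v from rfl, hBCB, LinearMap.smul_apply, smul_smul,
        inv_mul_cancel₀ ht, one_smul]
  · rw [LinearMap.smul_apply, Module.End.mul_apply, hCQ q hq, map_zero, smul_zero]
  · rw [LinearMap.smul_apply, LinearMap.smul_apply, LinearMap.sub_apply, Module.End.mul_apply, Module.End.mul_apply,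
      hBP p hp, map_zero, sub_zero]

/-! ## §2 A rank-one raising operator forces `𝔤_ℂ = 𝔰𝔭(V, ψ)_ℂ` -/

set_option maxHeartbeats 800000 in
/-- **One raising operator of rank one suffices: `𝔊 = 𝔰𝔭(V_ℂ, ψ_ℂ)`** (any rank).  `H` effective polarized of weight `1`;
`𝔊 ⊆ 𝔥_ℂ` bracket-closed, containing the Hodge operator `Θ`, conjugation-stable on the given `B`, acting on `V_ℂ` without
stable subspaces other than `0, V_ℂ`; `B ∈ 𝔊` raising with `dim range B = 1`.  Then every `ψ_ℂ`-skew operator lies in `𝔊`: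
by §1 (`r = 1` is minimal) `t⁻¹[B, B̄]` restricts to `P` as a rank-one idempotent `p ↦ ψ_ℂ(p, ξ) a`, and the tree's
`SymplecticThetaSix.core_of_rankOne` applies. [cite: MoonenZarhin1999LowDim, §2 (2.3)] [cite: GoodmanWallachGTM255, §2.1.2] -/
theorem WeightOneMinimalRaising.mem_of_skew_of_rank_one (H : HodgeStructure V n) (ψ : H.Polarization) (hn : n = 1)
    (heff : H.IsEffective) {Θ : Module.End ℂ (ℂ ⊗[ℚ] V)} (hΘ : ∀ p, ∀ x ∈ H.piece p (n - p), Θ x = ((2 * p - n : ℤ) : ℂ) • x)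
    {𝔊 : Submodule ℂ (Module.End ℂ (ℂ ⊗[ℚ] V))} (h𝔊 : 𝔊 ≤ H.hodgeLieC) (hbr : ∀ Y ∈ 𝔊, ∀ Z ∈ 𝔊, Y * Z - Z * Y ∈ 𝔊)
    (hΘ𝔊 : Θ ∈ 𝔊) (hirr : ∀ U : Submodule ℂ (ℂ ⊗[ℚ] V), (∀ Z ∈ 𝔊, ∀ u ∈ U, Z u ∈ U) → U = ⊥ ∨ U = ⊤)
    {B C : Module.End ℂ (ℂ ⊗[ℚ] V)} (hB : B ∈ 𝔊) (hBP : ∀ p ∈ H.piece 1 0, B p = 0) (hBim : ∀ v, B v ∈ H.piece 1 0)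
    (hC : ∀ v, C v = conj (B (conj v))) (hC𝔊 : C ∈ 𝔊) (hrk : Module.finrank ℂ (LinearMap.range B) = 1)
    {Y : Module.End ℂ (ℂ ⊗[ℚ] V)} (hY : ∀ x y, ψ.form.baseChange ℂ (Y x) y + ψ.form.baseChange ℂ x (Y y) = 0) : Y ∈ 𝔊 := by
  classical
  have hB0 : B ≠ 0 := fun h => by rw [h, LinearMap.range_zero, finrank_bot] at hrk; exact zero_ne_one hrk
  have hmin : ∀ B' ∈ 𝔊, B' ≠ 0 → (∀ p ∈ H.piece 1 0, B' p = 0) → (∀ v, B' v ∈ H.piece 1 0) →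
      Module.finrank ℂ (LinearMap.range B) ≤ Module.finrank ℂ (LinearMap.range B') := by
    intro B' _ hB'0 _ _
    rw [hrk]
    refine Nat.one_le_iff_ne_zero.2 fun h => hB'0 ?_
    exact LinearMap.range_eq_bot.1 (Submodule.finrank_eq_zero.1 h)
  obtain ⟨t, ht, hBCB⟩ := WeightOneMinimalRaising.mul_conjOp_mul_eq_smul H ψ hn heff hΘ h𝔊 hbr hB hB0 hBP hBim hC hC𝔊 hmin
  obtain ⟨-, hrange, -, hLevi⟩ := WeightOneMinimalRaising.isIdempotentElem_of_mul_conjOp_mul_eq_smul H hn heff hΘ hBP hBim hC ht hBCB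
  subst hn
  obtain ⟨hPmem, hQmem, hΘ10, hΘ01, hΘΘ⟩ := UnitaryTheta.theta_facts H rfl heff hΘ
  obtain ⟨hCQ, hCim, -, -⟩ := SymplecticThetaTen.conjOp_raise (P := H.piece 1 0) (Q := H.piece 0 1)
    (fun x hx => conj_mem_piece H hx) (fun x hx => conj_mem_piece H hx) hBP hBim hC
  set ω := ψ.form.baseChange ℂ with hω
  have hskew : ∀ Z ∈ 𝔊, ∀ x y, ω (Z x) y + ω x (Z y) = 0 := fun Z hZ x y => by
    rw [hω, formBaseChange_skew_of_mem_hodgeLieC ψ (h𝔊 hZ), neg_add_cancel]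
  have hωalt : ∀ x y, ω x y = -ω y x := fun x y => by rw [hω, form_baseChange_swap_of_odd H odd_one ψ y x]
  have hωnd : ω.Nondegenerate := by rw [hω]; exact ψ.nondegenerate_baseChange
  -- `range B = ℂ a`
  obtain ⟨a, ha⟩ : ∃ a : ℂ ⊗[ℚ] V, LinearMap.range B = ℂ ∙ a := by
    haveI : Module.Finite ℂ (LinearMap.range B) := inferInstance
    obtain ⟨a, ha⟩ := finrank_eq_one_iff'.1 hrk
    refine ⟨a, le_antisymm (fun x hx => ?_) ?_⟩
    · obtain ⟨c, hc⟩ := ha.2 ⟨x, hx⟩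
      exact Submodule.mem_span_singleton.2 ⟨c, by simpa using congrArg Subtype.val hc⟩
    · rw [Submodule.span_singleton_le_iff_mem]; exact a.2
  have ha0 : a ≠ 0 := fun h => hB0 (LinearMap.range_eq_bot.1 (by rw [ha, h, Submodule.span_singleton_eq_bot]))
  have haP : a ∈ H.piece 1 0 := by
    have h : a ∈ LinearMap.range B := by rw [ha]; exact Submodule.mem_span_singleton_self a
    obtain ⟨v, hv⟩ := LinearMap.mem_range.1 h
    rw [← hv]; exact hBim v
  -- the Levi element `Ze = t⁻¹ [B, C]` restricts to `P` as `p ↦ ω(p, ξ) a`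
  set E := t⁻¹ • (B * C) with hE
  have hEa : ∀ v, ∃ c : ℂ, E v = c • a := fun v => by
    have h : E v ∈ LinearMap.range B := by rw [← hrange]; exact LinearMap.mem_range_self E v
    rw [ha] at h
    obtain ⟨c, hc⟩ := Submodule.mem_span_singleton.1 h
    exact ⟨c, hc.symm⟩
  have hEaa : E a = a := by
    have h : a ∈ LinearMap.range E := by rw [hrange, ha]; exact Submodule.mem_span_singleton_self a
    obtain ⟨v, hv⟩ := LinearMap.mem_range.1 h
    obtain ⟨hidem, -, -, -⟩ := WeightOneMinimalRaising.isIdempotentElem_of_mul_conjOp_mul_eq_smul H rfl heff hΘ hBP hBim hC ht hBCB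
    rw [← hv, ← Module.End.mul_apply, hidem.eq]
  -- the functional `v ↦ c(v)` is `ω(·, ξ)` with `ξ ∈ Q`: use a vector `y₀` with `ω(a, y₀) ≠ 0` and skewness of `E`-ish via `B`, `C`
  -- concretely `E p = t⁻¹ B (C p)` and `ω(E p, y) = -t⁻¹ ω(C p, B̄…)`: we read `ξ` off the skewness of `B` and `C`.
  obtain ⟨y₀, hy₀⟩ : ∃ y₀, ω a y₀ ≠ 0 := by
    by_contra h
    push Not at h
    exact ha0 (hωnd.1 a h)
  -- coefficient functional
  have hcoef : ∀ v, E v = ((ω a y₀)⁻¹ * ω (E v) y₀) • a := fun v => by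
    obtain ⟨c, hc⟩ := hEa v
    rw [hc, map_smul, LinearMap.smul_apply, smul_eq_mul, ← mul_assoc, mul_comm _ c, mul_assoc, mul_comm (ω a y₀)⁻¹,
      mul_inv_cancel₀ hy₀, mul_one]
  -- `ω(E p, y₀) = ω(p, ξ₀)` with `ξ₀ = t⁻¹ C (B y₀)`… via skewness of `B` and `C` (both in `𝔊`)
  set ξ : ℂ ⊗[ℚ] V := (ω a y₀)⁻¹ • (t⁻¹ • C (B y₀)) with hξ
  have hξQ : ξ ∈ H.piece 0 1 := Submodule.smul_mem _ _ (Submodule.smul_mem _ _ (hCim _))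
  have hEform : ∀ p, ω (E p) y₀ = ω p (t⁻¹ • C (B y₀)) := fun p => by
    rw [hE, LinearMap.smul_apply, Module.End.mul_apply, map_smul, LinearMap.smul_apply, map_smul, smul_eq_mul, smul_eq_mul]
    congr 1
    have h1 := hskew B hB (C p) y₀
    have h2 := hskew C hC𝔊 p (B y₀)
    linear_combination h1 - h2
  have hZea : ∀ p ∈ H.piece 1 0, (t⁻¹ • (B * C - C * B)) p = ω p ξ • a := fun p hp => by
    rw [hLevi p hp, hcoef p, hEform p, hξ]
    simp only [map_smul, smul_eq_mul]
  have haξ : ω a ξ = 1 := by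
    have h := hcoef a
    rw [hEform a, hEaa] at h
    have h2 : ((ω a y₀)⁻¹ * ω a (t⁻¹ • C (B y₀)) - 1) • a = 0 := by rw [sub_smul, one_smul, ← h, sub_self]
    rw [smul_eq_zero] at h2
    rcases h2 with h2 | h2
    · rw [hξ]
      simp only [map_smul, smul_eq_mul] at h2 ⊢
      linear_combination h2
    · exact absurd h2 ha0
  have hZe𝔊 : t⁻¹ • (B * C - C * B) ∈ 𝔊 := Submodule.smul_mem _ _ (hbr B hB C hC𝔊)
  have hZeP : ∀ p ∈ H.piece 1 0, (t⁻¹ • (B * C - C * B)) p ∈ H.piece 1 0 := fun p hp => by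
    rw [hZea p hp]; exact Submodule.smul_mem _ _ haP
  obtain ⟨hplus, hlevi, hminus⟩ := SymplecticThetaSix.core_of_rankOne ω hωnd hωalt 𝔊 hbr hskew hΘ𝔊 hΘΘ hΘ10 hΘ01 hPmem hQmem
    hirr hZe𝔊 hZeP haP hξQ haξ hZea
  -- decompose `Y` along `ad Θ` inside the `ψ_ℂ`-skew operators (as in `SymplecticThetaTen.mem_spanC_of_skew_of_levi`)
  let 𝔰 : Submodule ℂ (Module.End ℂ (ℂ ⊗[ℚ] V)) :=
    { carrier := {Z | ∀ x y, ω (Z x) y + ω x (Z y) = 0}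
      zero_mem' := fun x y => by simp
      add_mem' := by
        intro Z Z' hZ hZ' x y
        simp only [LinearMap.add_apply, map_add]
        have h1 := hZ x y
        have h2 := hZ' x y
        linear_combination h1 + h2
      smul_mem' := by
        intro c Z hZ x y
        simp only [LinearMap.smul_apply, map_smul, smul_eq_mul]
        have h1 := hZ x y
        linear_combination c * h1 }
  have hmem𝔰 : ∀ Z, Z ∈ 𝔰 ↔ ∀ x y, ω (Z x) y + ω x (Z y) = 0 := fun Z => Iff.rfl
  have h𝔰br : ∀ Z ∈ 𝔰, ∀ Z' ∈ 𝔰, Z * Z' - Z' * Z ∈ 𝔰 := by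
    intro Z hZ Z' hZ'
    rw [hmem𝔰] at hZ hZ' ⊢
    intro x y
    simp only [LinearMap.sub_apply, Module.End.mul_apply, map_sub]
    have h1 := hZ (Z' x) y
    have h2 := hZ x (Z' y)
    have h3 := hZ' (Z x) y
    have h4 := hZ' x (Z y)
    linear_combination h1 - h4 + h2 - h3
  have hΘ𝔰 : Θ ∈ 𝔰 := (hmem𝔰 Θ).2 (hskew Θ hΘ𝔊)
  have hY𝔰 : Y ∈ 𝔰 := (hmem𝔰 Y).2 hY
  obtain ⟨Ym, hYm, Y0, hY0, Yp, hYp, hYeq, hYpP, hYpim, hYmQ, hYmim, -, -, hY0P, hY0Q⟩ :=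
    SymplecticTheta.exists_decomp 𝔰 h𝔰br hΘ𝔰 hΘΘ (P := H.piece 1 0) (Q := H.piece 0 1) hΘ10 hΘ01 hPmem hQmem hY𝔰
  rw [hYeq]
  refine Submodule.add_mem _ (Submodule.add_mem _ ?_ ?_) ?_
  · exact hminus Ym ((hmem𝔰 Ym).1 hYm) hYmQ hYmim
  · exact hlevi Y0 ((hmem𝔰 Y0).1 hY0) hY0P hY0Q
  · exact hplus Yp ((hmem𝔰 Yp).1 hYp) hYpP hYpim

end HodgeStructure

end Literature.AlgebraicGeometry.Motives
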